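import Summits.QuantumFields.YangMills.Theorems.BalabanUVNodesN16HolderMSOfLeafTop
import HarnessLib

/-!
# Route «BalabanUVNodes», cluster K4 «SpineRates» — node N16 = NE3: THE N05 → N16 EDGE WITH THE (1.36)₃ MEMBER MULTI-SCALE AT PRINT's ℓ¹ LENGTH — no length
# letter left (repair R-β″; corollary of file 36 `N16HolderMSOfLeafTop.n16_holderMS_of_b8LeafRS` at `len := B9Eq340HolderZd.l1Len`)

Cell `pub-ymgap`, seat `pub-ymgap-dag-n16-c` (R134 fan-out seat, strategy s1; HUMAN RULING D-0062; chair R424 venue), generation 4, file 38.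
`--supports stmt-QuantumFields-19912 --as helper` (K3‴ `SpineGivenEndpointR13`, route rev 16).  `bears_on: R4∕N16 · edge N05 → N16`.  Located item:
`HOME/pub-ymgap-dag-n16-c/LOCATED-N16-HOLDER-PIN.md`, census row R-β″ (ADDENDA 5–6).

WHY.  File 36 carries two letters on the leaf's length function `len` — `len ≥ 1` on its support (generation 0's) and the new `len (j•e_μ) = j` of R-β″.  Print's
«|x′ − x|» in [Balaban1985BackgroundPropagators] (3.40) is a genuine lattice length; at the ℓ¹ reading `l1Len` (the tree's `B9Eq340HolderZd.l1Len`) BOTH letters are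
theorems (`one_le_l1Len`; `l1Len (j•e_μ) = j` from `B7Prop1Explicit.l1_zsmul_e`).  So R-β″'s producer column asks NOTHING of node N05 beyond its leaf-of-record SHAPE at
`len := l1Len` and a residual Hölder exponent `β ∈ [0, 1]` — the ruling's «extra socket letter» objection is void at print's own length.

WHAT THIS FILE PROVES (kernel, theorems only, 0 `def`, 0 sorry): `l1Len_nsmul_e` (`l1Len (j • e μ) = j`), ★ `n16_holderMS_of_b8LeafRS_l1Len` (file 36's ★ with
`len := l1Len`, both length letters discharged).
HONEST FRAMING: a two-line corollary; the leaf (`B8LeafRS` on `zdGF3 … β l1Len`) is node N05's theorem (in the tree modulo its sockets), (H3ˢᵘᵖ) is N07's; N16 ∕ NE3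
NOT discharged; count-neutral; one finite four-torus at fixed ε — NOT ℝ⁴, NOT infinite volume, NOT OS, NOT a mass gap, NOT Clay.
-/

set_option autoImplicit false

open scoped BigOperators Matrix Matrix.Norms.L2Operator
open NormedSpace

namespace Summit.QuantumFields.YangMills.BalabanUVNodes.N16HolderMSOfLeafL1

open Literature.MathematicalPhysics.QuantumFieldTheory.Balaban1983to89
open B7Prop1Explicit B7Prop2Explicit
open B7Prop3Flat (c3)
open T4AveragingDeficitWall (Ad)
open B7Eq92Concrete (mgauge)
open B8Ineq132 (covDerivFwd InAk)
open B8Eq184Proof (cfgExp)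
open B8Eq119TwistedAxial (Restr129)
open B8Eq133Hypotheses (Reg335Zd)
open B8Eq138LandauZd (covLap IsLandau138)
open B8Thm4TorusAt (torusLam Thm4TorusAt)
open B8LeafModelZd (ZdIdx)
open B8LeafModelZd3 (zdGF3)
open B8LeafKnitRS (B8LeafRS)
open Summit.QuantumFields.BalabanUV.T4Continuum
open BlockAverageCurrent (curConst)
open NE3RightInverseSupLetters (frameC)
open NE3.LeafIndexSockets (LeafH3sup)
open MinimalActionRate (sfClass)
open Summit.QuantumFields.YangMills.BalabanUVNodes.N16HolderMSDefs (CovRootHolderMS)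
open Summit.QuantumFields.YangMills.BalabanUVNodes.N16HolderMSOfThm4Output (n16_holderMS_of_thm4TorusAt_printMS)
open Summit.QuantumFields.YangMills.BalabanUVNodes.N16HolderMSTorusOfZd (thm4TorusAt_printMS_of_zd)
open Summit.QuantumFields.YangMills.BalabanUVNodes.N16.OfLeaf (exists_window_print)
open Summit.QuantumFields.YangMills.BalabanUVNodes.N16HolderMSOfLeaf (thm4TorusAt_printMS_of_leaf)

open B9Eq340HolderZd (l1Len one_le_l1Len)

noncomputable section

open N16HolderMSOfLeafTop (n16_holderMS_of_b8LeafRS)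

/-- Print's ℓ¹ length of the straight displacement: `l1Len (j • e μ) = j` (`B7Prop1Explicit.l1_zsmul_e`). [cite: Balaban1985BackgroundPropagators, (3.40) p.397] [folklore] -/
theorem l1Len_nsmul_e (μ : Fin 4) (j : ℕ) : l1Len (j • e μ : Site 4) = j := by
  unfold l1Len
  rw [← natCast_zsmul, l1_zsmul_e, Int.natAbs_natCast]

section Matrices

variable {n : Type} [Fintype n] [DecidableEq n]

/-- ★ **THE N05 → N16 EDGE WITH THE MULTI-SCALE MEMBER AT PRINT's ℓ¹ LENGTH** (`d = 4`, `L ≥ 2`, `N ≥ 1`): file 36's `n16_holderMS_of_b8LeafRS` at `len := l1Len`, the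
two length letters discharged by `one_le_l1Len` and `l1Len_nsmul_e` — node N05's leaf-of-record SHAPE `B8LeafRS` on `zdGF3 (M_n ℂ) L β l1Len` at ANY `β ∈ [0,1]` + N07's
`LeafH3sup` + THE END's letters ⟹ `CovRootHolderMS 4 (sfClass 4 L N ε) L N b g C s₁ s₂ β dom`.  N16 ∕ NE3 NOT proved: the leaf and (H3ˢᵘᵖ) are the hypotheses.
[cite: Balaban1985RegularSpaces, Thm 4 p.88, Prop. 3 p.87, (1.36) p.82; Balaban1985BackgroundPropagators, (3.40) p.397] [folklore] -/
theorem n16_holderMS_of_b8LeafRS_l1Len [Nonempty n] {L N : ℕ} (hL : 2 ≤ L) (hN : 1 ≤ N) :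
    letI : CStarAlgebra (Matrix n n ℂ) := {}
    ∃ r : ℝ, 0 < r ∧ ∀ ⦃g : ℝ⦄, 0 < g → ∃ C : ℝ, 0 ≤ C ∧
      ∀ {I₁ I₃ I₄ : Type} ⦃β : ℝ⦄, 0 ≤ β → β ≤ 1 → ∀ (C₂ B₁' B₀' B₁ B₂ c₁ : ℝ) (inp : B8.B9Inputs) (B₀β : ℝ) (loc : I₁ → B8.LocalData)
        (lan : I₃ → B8.LandauData) (cub : I₄ → B8.CubeData)
        (toAxial : ∀ i : {i : ZdIdx 4 L // i.Ω 0 = Set.univ},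
          (zdGF3 (Matrix n n ℂ) L β l1Len i.1).Cfg → (zdGF3 (Matrix n n ℂ) L β l1Len i.1).Pert → (zdGF3 (Matrix n n ℂ) L β l1Len i.1).Pert),
      0 < B₁' → 5 * ((4 : ℕ) : ℝ) * L * inp.B₀ ≤ B₁' →
      B8LeafRS 4 (L : ℝ) C₂ B₁' B₀' B₁ B₂ c₁ inp B₀β loc
        (fun i : {i : ZdIdx 4 L // i.Ω 0 = Set.univ} => zdGF3 (Matrix n n ℂ) L β l1Len i.1) lan cub toAxial →
      ∃ c₁' : ℝ, 0 < c₁' ∧ 16 * (5 * ((4 : ℕ) : ℝ) * L * inp.B₀ * c₁') ≤ 1 ∧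
      ∀ ⦃b' c' : ℝ⦄, 0 ≤ b' → 0 ≤ c' →
      2 ^ 15 * ((4 : ℝ) + 1) ^ 2 * ((4 : ℝ) + 4) ^ 2 * (L : ℝ) ^ 2 * b' ≤ 1 →
      23040 * (4 : ℝ) ^ 4 * (frameC 4 L + 4) ^ 3 * (c' + curConst 4 L * b' ^ 2) ≤ 1 →
      ∀ ⦃α : ℝ⦄, 0 < α → C0 4 * α ≤ 1 / 3 → 2 * α ≤ c2' 4 L → 11 * (4 : ℝ) ^ 2 * α ≤ 1 / 6 → α + 11 * (4 : ℝ) ^ 2 * α ≤ c₁' →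
      b' + 226 * (8 * ((4 : ℝ) + 1) * ((4 : ℝ) + 4)) ^ 2 * b' ^ 2 < α → 4 * ((4 : ℝ) - 1) * (c' + curConst 4 L * b' ^ 2) < α →
      ∀ ⦃Mc : ℝ⦄, 0 ≤ Mc → (Mc + 1) * (b' + 226 * (8 * ((4 : ℝ) + 1) * ((4 : ℝ) + 4)) ^ 2 * b' ^ 2) ≤ 1 / 2 →
      ∀ (𝒬 : ℕ → Set (Set (Site 4) × ℕ)), (∀ k, ∀ q ∈ 𝒬 k, q.2 ≤ k ∧ ∃ y : Site 4, ∀ z ∈ q.1, (l1 (z - y) : ℝ) ≤ Mc * (L : ℝ) ^ q.2) →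
      ∀ ⦃C335 : ℝ⦄, 2 * (Mc + 1) * (b' + 226 * (8 * ((4 : ℝ) + 1) * ((4 : ℝ) + 4)) ^ 2 * b' ^ 2) + 2 * Mc * (2 * (c' + curConst 4 L * b' ^ 2)) +
        4 * Mc * (1 + 2 * Mc) * (b' + 226 * (8 * ((4 : ℝ) + 1) * ((4 : ℝ) + 4)) ^ 2 * b' ^ 2) ^ 2 < C335 →
      ∀ ⦃ε s₁ b s₂ : ℝ⦄, 0 < ε → ε ≤ r → ε < α → 0 ≤ s₁ → s₁ ≤ r → 0 ≤ b → b ≤ ε / 2 →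
      5 * ((4 : ℕ) : ℝ) * L * inp.B₀ * (α + 11 * (4 : ℝ) ^ 2 * α) ≤ s₁ →
      5 * ((4 : ℕ) : ℝ) * L * inp.B₀ * (α + 11 * (4 : ℝ) ^ 2 * α) +
          2 * (b' + 226 * (8 * ((4 : ℝ) + 1) * ((4 : ℝ) + 4)) ^ 2 * b' ^ 2) * s₁ ≤ s₁ →
      5 * ((4 : ℕ) : ℝ) * L * inp.B₀ * (α + 11 * (4 : ℝ) ^ 2 * α) + 16 * (b' + 226 * (8 * ((4 : ℝ) + 1) * ((4 : ℝ) + 4)) ^ 2 * b' ^ 2) *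
          (5 * ((4 : ℕ) : ℝ) * L * inp.B₀ * (α + 11 * (4 : ℝ) ^ 2 * α)) ≤ s₁ →
      5 * ((4 : ℕ) : ℝ) * L * B₀β * (α + 11 * (4 : ℝ) ^ 2 * α) + 10 * (b' + 226 * (8 * ((4 : ℝ) + 1) * ((4 : ℝ) + 4)) ^ 2 * b' ^ 2) *
          (5 * ((4 : ℕ) : ℝ) * L * inp.B₀ * (α + 11 * (4 : ℝ) ^ 2 * α)) ≤ s₂ →
      ∀ {dom : _root_.Set (Site 4 → Fin 4 → (Matrix n n ℂ)ˣ)},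
        LeafH3sup 4 L N ε b' c' dom →
        CovRootHolderMS 4 (sfClass 4 L N ε) L N b g C s₁ s₂ β dom := by
  letI : CStarAlgebra (Matrix n n ℂ) := {}
  obtain ⟨r, hr0, hr⟩ := n16_holderMS_of_b8LeafRS (n := n) hL hN
  refine ⟨r, hr0, fun g hg => ?_⟩
  obtain ⟨C, hC0, hC⟩ := hr hg
  exact ⟨C, hC0, fun {I₁ I₃ I₄} β hβ0 hβ1 C₂ B₁' B₀' B₁ B₂ c₁ inp B₀β loc lan cub toAxial hB₁' hBB leaf =>
    hC hβ0 hβ1 C₂ B₁' B₀' B₁ B₂ c₁ inp B₀β loc lan cub l1Len toAxial (fun v hv => one_le_l1Len hv) l1Len_nsmul_e hB₁' hBB leaf⟩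

end Matrices

end

end Summit.QuantumFields.YangMills.BalabanUVNodes.N16HolderMSOfLeafL1
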